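import Summits.QuantumFields.YangMills.Theorems.FluctuationComparisonRegPrIntLWregChainNull
import Summits.QuantumFields.YangMills.Theorems.FluctuationComparisonRegPrIntLWregChartCharge
import Summits.QuantumFields.YangMills.Theorems.BalabanUVNodesN09CentralWindowJacobianGraphContinuous
import HarnessLib

/-!
# CHART∞ · I (LINE g18-1 `semiclassical_s2beta`, organ S2β, LAPLACE row): the (0.4)-chain is JOINTLY continuous in (environment, pivot) on the guarded window graph

R3 = Balaban's UV-stability programme on the finite 3-torus, gauge group `SU(N)` (generic `(P, N)` here) — NOT d = 4, NOT infinite volume, NOT a mass gap,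
NOT Clay; the Yang–Mills gap is NOT proved by anything in this file.  Helper toward crux `stmt-QuantumFields-20520` (`FluctuationComparisonRegPrIntL`),
LINE g18-1 `Cruxes/FluctuationComparisonRegPrIntL/Lines/semiclassical_s2beta.lean`, LAPLACE row, letter CHART∞ (continuity of the fibre amplitude of the
height density in the fibre variable — the measure-side input of `Literature.Analysis.Asymptotics.LaplaceMethodOrbitCompact`).

The WREG port (✓F1b∕F1c `…WregChainLaw`∕`…WregChainNull`, ✓F2 `…WregFibredChart`) proves everything about the chain `g ↦ chainMap 𝓔 n U c g` at a FIXED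
environment `U` (continuity on the compact window, forward law with a density continuous on the window, Lusin–Souslin inverse).  This file adds the
ENVIRONMENT direction, on the guarded graph `G_n(c) = {(U, g) | every loop variable of Ū⁽ᵏ⁾(U), k < n, is ≤ α ∧ g ∈ chainWindow α n U c}` (off the small-history
guard `Ū⁽ᵏ⁾` is discontinuous, so no statement on the whole window graph is true):

* §1 ★`continuousAt_chainMap₂` — `(U, g) ↦ chainMap 𝓔 n U c g` is continuous at every point of `G_n(c)` (induction through ✓`chainMap_succ` on the one-bond
  joint continuity ✓`continuousAt_fibreMap₂_of_fibreSmall` and ✓`continuousAt_iter_of_loopSmall`);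
* §2 ★`exists_jacobian_forwardLaws_lb_graph` — F1b's one-step Jacobian with lower bound (`hvol : j₀ = 0 ∨ ChainVol`), GRAPH-continuous edition (N09
  ✓`exists_jacobian_forwardLaws_continuousOn_graph` + F1b's `max jac j₀`);
* §3 ★★`chain_forwardLaw_contOn` — ✓`chain_forwardLaw_lb`'s induction VERBATIM on §2 (same six conjuncts: measurable ∕ `≠ 0` ∕ law ∕ fibre continuity ∕ `j₀ⁿ ≤ J`)
  plus a seventh: the chain's forward-law density `J` is jointly continuous on `G_n(c)`.
Part II (`…S2BetaChartContChainCharts`) proves `G_n(c)` closed and feeds §1 + §3 to `Literature.Topology.ParametricInverse` (parametrised inverses on compact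
fibres are jointly continuous): the per-bond inversion data of ✓`exists_chainCharts_lb` become jointly continuous on the guarded image graph.
-/

noncomputable section

open MeasureTheory Filter Topology Set Function
open scoped ENNReal NNReal
open Literature.MathematicalPhysics.QuantumFieldTheory.Balaban1983to89
open Literature.MathematicalPhysics.QuantumFieldTheory.Balaban1983to89.T4Continuum
open Literature.MathematicalPhysics.QuantumFieldTheory.Balaban1983to89.BlockAveraging (Idx avgFun measurable_avgFun loopHol)
open Literature.MathematicalPhysics.QuantumFieldTheory.Balaban1983to89.BlockAveragingHaarAC (centralBond pre post)
open Literature.MathematicalPhysics.QuantumFieldTheory.Balaban1983to89.BlockAveragingEMLHaarAC (fibreFamily offCard fibreMap FibreSmall avgFun_update_centralBond_self)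
open Literature.MathematicalPhysics.QuantumFieldTheory.Balaban1983to89.ExpMeanLog (expMeanLogSU deltaSU deltaSU_pos measurable_expMeanLogSU_E)
open Literature.MathematicalPhysics.QuantumFieldTheory.Balaban1983to89.Node00 (SU)
open Summit.QuantumFields.YangMills.BalabanUVNodes.N09CentralWindowAtRecord (avgFun_update_centralBond_injOn_centralWindow self_mem_centralWindow_iff)
open Summit.QuantumFields.YangMills.BalabanUVNodes.N09CentralWindowChart (fibreSmall_of_mem_window)
open Summit.QuantumFields.YangMills.BalabanUVNodes.N09CentralWindowJacobianGraphContinuous (exists_jacobian_forwardLaws_continuousOn_graph)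
open Summit.QuantumFields.YangMills.Theorems.FluctuationComparisonRegPrIntLWregChain
open Summit.QuantumFields.YangMills.Theorems.FluctuationComparisonRegPrIntLWregChartChargeOneStep (continuousAt_fibreMap₂_of_fibreSmall continuous_fibreFamily₂)
open Summit.QuantumFields.YangMills.Theorems.FluctuationComparisonRegPrIntLWregChartCharge (continuousAt_iter_of_loopSmall)

namespace Summit.QuantumFields.YangMills.Theorems.FluctuationComparisonRegPrIntLS2BetaChartContChain

variable {P : Params} {N : ℕ} [NeZero N]

/-- ★ **THE CHAIN MAP IS JOINTLY CONTINUOUS IN (ENVIRONMENT, PIVOT) AT GUARDED POINTS**: for `n ≤ m+K`, `U₀` whose intermediate averages `Ū⁽ᵏ⁾(U₀)`, `k < n`,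
have loop variables `≤ α < δ_N`, and `g₀ ∈ chainWindow α n U₀ c`, the map `(U, g) ↦ chainMap 𝓔 n U c g` is continuous at `(U₀, g₀)` — induction through
✓`chainMap_succ`: the one-bond fibre map is jointly continuous at guard points (✓`continuousAt_fibreMap₂_of_fibreSmall`), the environment `Ū⁽ⁿ⁾` is continuous at
`U₀` (✓`continuousAt_iter_of_loopSmall`), and the chain value at `centralBond c` lies in the environment's window (✓`fibreSmall_of_mem_window`).
[cite: Balaban1987RG1, (0.4) p.253] -/
theorem continuousAt_chainMap₂ {α : ℝ} (hαδ : α < deltaSU (Fin N)) :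
    ∀ {n : ℕ}, n ≤ P.m + P.K → ∀ (c : PBond P n) (U₀ : GaugeField P 0 (SU N)) (g₀ : SU N),
      (∀ k, k < n → ∀ (c' : PBond P (k + 1)) (i : Idx P),
        dist1 (loopHol (Averaging.iter (fun i => BlockAveraging.blockAvg (P := P) (j := i) (expMeanLogSU (n := Fin N))) k U₀) c' i) ≤ α) →
      g₀ ∈ chainWindow (N := N) α n U₀ c →
      ContinuousAt (fun p : GaugeField P 0 (SU N) × SU N => chainMap (expMeanLogSU (n := Fin N)) n p.1 c p.2) (U₀, g₀)
  | 0, _, c, U₀, g₀, _, _ => by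
      have h : (fun p : GaugeField P 0 (SU N) × SU N => chainMap (expMeanLogSU (n := Fin N)) 0 p.1 c p.2) = fun p => p.2 :=
        funext fun p => chainMap_zero _ p.1 c p.2
      rw [h]; exact continuousAt_snd
  | n + 1, hn, c, U₀, g₀, hsmall, hg₀ => by
      classical
      have IH := continuousAt_chainMap₂ hαδ (n := n) (by omega) (centralBond c) U₀ g₀ (fun k hk => hsmall k (by omega))
        ((chainWindow_succ α n U₀ c ▸ hg₀).1)
      have hA : ContinuousAt (Averaging.iter (fun i => BlockAveraging.blockAvg (P := P) (j := i) (expMeanLogSU (n := Fin N))) n) U₀ :=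
        continuousAt_iter_of_loopSmall (N := N) hαδ U₀ fun k hk => hsmall k (by omega)
      set W₀ := Averaging.iter (fun i => BlockAveraging.blockAvg (P := P) (j := i) (expMeanLogSU (n := Fin N))) n U₀ with hW₀
      set h₀ := chainMap (expMeanLogSU (n := Fin N)) n U₀ (centralBond c) g₀ with hh₀
      have hwin : ∀ i : Idx P, dist1 (fibreFamily W₀ c (pre W₀ c * h₀ * post W₀ c) i) ≤ α := (chainWindow_succ α n U₀ c ▸ hg₀).2
      have hfs : FibreSmall (expMeanLogSU (n := Fin N)) W₀ c (pre W₀ c * h₀ * post W₀ c) := fibreSmall_of_mem_window W₀ c hαδ hwin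
      have hE := continuousAt_fibreMap₂_of_fibreSmall (N := N) c hfs
      -- the inner map `(U, g) ↦ (Ū⁽ⁿ⁾ U, pre·chainMap n U (cb c) g·post)` is continuous at `(U₀, g₀)`
      have henv : ContinuousAt (fun p : GaugeField P 0 (SU N) × SU N =>
          Averaging.iter (fun i => BlockAveraging.blockAvg (P := P) (j := i) (expMeanLogSU (n := Fin N))) n p.1) (U₀, g₀) :=
        hA.comp_of_eq continuousAt_fst rfl
      have hpre : ContinuousAt (fun p : GaugeField P 0 (SU N) × SU N =>
          pre (Averaging.iter (fun i => BlockAveraging.blockAvg (P := P) (j := i) (expMeanLogSU (n := Fin N))) n p.1) c) (U₀, g₀) :=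
        (BlockAveraging.continuous_holAt _).continuousAt.comp_of_eq henv rfl
      have hpost : ContinuousAt (fun p : GaugeField P 0 (SU N) × SU N =>
          post (Averaging.iter (fun i => BlockAveraging.blockAvg (P := P) (j := i) (expMeanLogSU (n := Fin N))) n p.1) c) (U₀, g₀) :=
        (BlockAveraging.continuous_holAt _).continuousAt.comp_of_eq henv rfl
      have hinner : ContinuousAt (fun p : GaugeField P 0 (SU N) × SU N =>
          ((Averaging.iter (fun i => BlockAveraging.blockAvg (P := P) (j := i) (expMeanLogSU (n := Fin N))) n p.1,
            pre (Averaging.iter (fun i => BlockAveraging.blockAvg (P := P) (j := i) (expMeanLogSU (n := Fin N))) n p.1) c *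
              chainMap (expMeanLogSU (n := Fin N)) n p.1 (centralBond c) p.2 *
              post (Averaging.iter (fun i => BlockAveraging.blockAvg (P := P) (j := i) (expMeanLogSU (n := Fin N))) n p.1) c) :
            GaugeField P n (SU N) × SU N)) (U₀, g₀) :=
        henv.prodMk ((hpre.mul IH).mul hpost)
      have hcomp := ContinuousAt.comp_of_eq hE hinner rfl
      refine hcomp.congr (Eventually.of_forall fun p => ?_)
      simp only [Function.comp_apply]
      rw [chainMap_succ _ hn, avgFun_update_centralBond_self hn]


/-- ★ **N09's ONE-STEP JACOBIAN — GRAPH-CONTINUOUS EDITION WITH A LOWER BOUND** (✓`exists_jacobian_forwardLaws_lb` of F1b re-run on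
✓`exists_jacobian_forwardLaws_continuousOn_graph`): the same five conjuncts as F1b (measurable, `≠ 0` on the window, forward law, fibre continuity, `j₀ ≤ jac`
under CHART-VOL or trivially `j₀ = 0`) PLUS joint continuity of `(U, g) ↦ jac c U g` on the one-step window graph `{(U, g) | g ∈ centralWindowSet U c α}`
(the `max jac j₀` of F1b preserves it). [cite: Balaban1987RG1, (0.4) p.253 and (2.10) p.267; Balaban1985Averaging, Prop. 1 p.25] -/
theorem exists_jacobian_forwardLaws_lb_graph {j : ℕ} (hj : j + 1 ≤ P.m + P.K) {α : ℝ} (hα0 : 0 ≤ α) (hα24 : α ≤ 1 / 24)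
    (hα64 : 64 * α ≤ deltaSU (Fin N)) (hαL : 157 * α < ((P.L : ℝ) ^ (P.d - 1))⁻¹)
    (hgap : ∀ c : PBond P (j + 1), (offCard c : ℝ) / (Fintype.card (Idx P) : ℝ) + 150 * α < 1)
    {j₀ : ℝ≥0} (hvol : j₀ = 0 ∨ ChainVol P N α j₀) :
    ∃ jac : PBond P (j + 1) → GaugeField P j (SU N) → SU N → ℝ≥0,
      (∀ c, Measurable fun p : GaugeField P j (SU N) × SU N => jac c p.1 p.2) ∧
      (∀ c U g, g ∈ centralWindowSet U c α → jac c U g ≠ 0) ∧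
      (∀ c U, (HaarData.haar : Measure (SU N)).restrict
          ((fun g : SU N => avgFun (expMeanLogSU (n := Fin N)) (update U (centralBond c) g) c) '' centralWindowSet U c α) =
        (((HaarData.haar : Measure (SU N)).restrict (centralWindowSet U c α)).withDensity fun g => (jac c U g : ℝ≥0∞)).map
          (fun g : SU N => avgFun (expMeanLogSU (n := Fin N)) (update U (centralBond c) g) c)) ∧
      (∀ c U, ContinuousOn (jac c U) (centralWindowSet U c α)) ∧
      (∀ c U g, j₀ ≤ jac c U g) ∧
      (∀ c, ContinuousOn (fun p : GaugeField P j (SU N) × SU N => jac c p.1 p.2)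
        {p : GaugeField P j (SU N) × SU N | p.2 ∈ centralWindowSet p.1 c α}) := by
  have hαδ : α < deltaSU (Fin N) := by nlinarith [deltaSU_pos (n := Fin N)]
  obtain ⟨jac, hm, h0, hlaw, hc, hg⟩ := exists_jacobian_forwardLaws_continuousOn_graph (N := N) (P := P) hj hα0 hα24 hα64 hαL hgap
  by_cases hj₀ : j₀ = 0
  · exact ⟨jac, hm, fun c U g hg' => h0 c U g hg', fun c U => hlaw c U, fun c U => hc c U, fun c U g => by rw [hj₀]; exact bot_le, fun c => hg c⟩
  have hvol' : ChainVol P N α j₀ := hvol.resolve_left hj₀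
  have hj₀' : 0 < j₀ := pos_iff_ne_zero.2 hj₀
  refine ⟨fun c U g => max (jac c U g) j₀, fun c => (hm c).max measurable_const, fun c U g _ => (lt_of_lt_of_le hj₀' (le_max_right _ _)).ne',
    fun c U => ?_, fun c U => continuous_max.comp_continuousOn ((hc c U).prodMk continuousOn_const), fun c U g => le_max_right _ _,
    fun c => continuous_max.comp_continuousOn ((hg c).prodMk continuousOn_const)⟩
  dsimp only
  set Ω := centralWindowSet U c α with hΩ
  set Fm := fun g : SU N => avgFun (expMeanLogSU (n := Fin N)) (update U (centralBond c) g) c with hFm_def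
  have hΩm : MeasurableSet Ω := measurableSet_centralWindowSet U c α
  have hFmeas : Measurable Fm := (measurable_pi_apply c).comp ((measurable_avgFun _ measurable_expMeanLogSU_E).comp (measurable_update _))
  have hinj : InjOn Fm Ω := fun g₁ hg₁ g₂ hg₂ h => avgFun_update_centralBond_injOn_centralWindow hj _ c hα0 hα24 hαδ (hgap c) hg₁ hg₂ h
  have hae : ∀ᵐ g ∂(HaarData.haar : Measure (SU N)).restrict Ω, (j₀ : ℝ≥0∞) ≤ (jac c U g : ℝ≥0∞) := by
    refine ae_le_of_forall_setLIntegral_le_of_sigmaFinite measurable_const fun s hs _ => ?_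
    have hA : MeasurableSet (s ∩ Ω) := hs.inter hΩm
    have hFA : MeasurableSet (Fm '' (s ∩ Ω)) := hA.image_of_measurable_injOn hFmeas (hinj.mono inter_subset_right)
    have h1 : ∫⁻ _ in s, (j₀ : ℝ≥0∞) ∂(HaarData.haar : Measure (SU N)).restrict Ω = (j₀ : ℝ≥0∞) * (HaarData.haar : Measure (SU N)) (s ∩ Ω) := by
      rw [Measure.restrict_restrict hs, setLIntegral_const]
    have h2 : ∫⁻ g in s, (jac c U g : ℝ≥0∞) ∂(HaarData.haar : Measure (SU N)).restrict Ω = (HaarData.haar : Measure (SU N)) (Fm '' (s ∩ Ω)) := by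
      have hlaw' : (HaarData.haar : Measure (SU N)).restrict (Fm '' Ω) =
          (((HaarData.haar : Measure (SU N)).restrict Ω).withDensity fun g => (jac c U g : ℝ≥0∞)).map Fm := hlaw c U
      have happ := congrArg (fun μ : Measure (SU N) => μ (Fm '' (s ∩ Ω))) hlaw'
      rw [Measure.restrict_apply hFA, Set.inter_eq_left.2 (Set.image_mono inter_subset_right), Measure.map_apply hFmeas hFA,
        withDensity_apply _ (hFmeas hFA), Measure.restrict_restrict (hFmeas hFA), hinj.preimage_image_inter inter_subset_right] at happ
      rw [Measure.restrict_restrict hs, happ]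
    rw [h1, h2]
    exact hvol' j hj U c (s ∩ Ω) hA inter_subset_right
  have hcongr : ((HaarData.haar : Measure (SU N)).restrict Ω).withDensity (fun g => ((max (jac c U g) j₀ : ℝ≥0) : ℝ≥0∞)) =
      ((HaarData.haar : Measure (SU N)).restrict Ω).withDensity fun g => (jac c U g : ℝ≥0∞) := by
    refine withDensity_congr_ae ?_
    filter_upwards [hae] with g hg
    rw [max_eq_left (by exact_mod_cast hg)]
  rw [hcongr]
  exact hlaw c U

/-- ★★ **THE CHAIN'S FORWARD-LAW DENSITY, JOINTLY CONTINUOUS IN (ENVIRONMENT, PIVOT) ON THE GUARDED WINDOW GRAPH**: the induction of ✓`chain_forwardLaw_lb` (F1c)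
VERBATIM (same six conjuncts, same `hvol`) on the one-step Jacobian of ✓`exists_jacobian_forwardLaws_lb_graph` (continuous on the one-step GRAPH), carrying
the extra conjunct: the chain density `(U, g) ↦ J U g` is JOINTLY continuous on the guarded window graph `{(U, g) : U has small loop history below
level n (`Ū⁽ᵏ⁾(U)`, `k < n`, loop variables `≤ α`) ∧ g ∈ chainWindow α n U c}` — by ✓`continuousAt_chainMap₂`, ✓`continuousAt_iter_of_loopSmall` and
`ContinuousOn.comp` into the one-step graph (second clause of ✓`chainWindow_succ`).  This is the measure-side input of CHART∞ (continuity of the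
fibre amplitude `a_V` in the environment `V`).  [cite: Balaban1987RG1, (0.4) p.253; Balaban1985Averaging, Prop. 1 p.25] -/
theorem chain_forwardLaw_contOn {α : ℝ} (hα0 : 0 ≤ α) (hα24 : α ≤ 1 / 24) (hα64 : 64 * α ≤ deltaSU (Fin N))
    (hαL : 157 * α < ((P.L : ℝ) ^ (P.d - 1))⁻¹)
    (hgap : ∀ j (c : PBond P (j + 1)), (offCard c : ℝ) / (Fintype.card (Idx P) : ℝ) + 150 * α < 1)
    {j₀ : ℝ≥0} (hvol : j₀ = 0 ∨ ChainVol P N α j₀) (n : ℕ) :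
    n ≤ P.m + P.K → ∀ c : PBond P n, ∃ J : GaugeField P 0 (SU N) → SU N → ℝ≥0,
      (Measurable fun p : GaugeField P 0 (SU N) × SU N => J p.1 p.2) ∧
      (∀ U, ∀ g ∈ chainWindow α n U c, J U g ≠ 0) ∧
      (∀ U, (HaarData.haar : Measure (SU N)).restrict (chainMap (expMeanLogSU (n := Fin N)) n U c '' chainWindow α n U c) =
        (((HaarData.haar : Measure (SU N)).restrict (chainWindow α n U c)).withDensity fun g => (J U g : ℝ≥0∞)).map
          (chainMap (expMeanLogSU (n := Fin N)) n U c)) ∧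
      (∀ U, ContinuousOn (J U) (chainWindow α n U c)) ∧
      (∀ U g, j₀ ^ n ≤ J U g) ∧
      ContinuousOn (fun p : GaugeField P 0 (SU N) × SU N => J p.1 p.2)
        {p : GaugeField P 0 (SU N) × SU N |
          (∀ k, k < n → ∀ (c' : PBond P (k + 1)) (i : Idx P),
            dist1 (loopHol (Averaging.iter (fun i => BlockAveraging.blockAvg (P := P) (j := i) (expMeanLogSU (n := Fin N))) k p.1) c' i) ≤ α) ∧
          p.2 ∈ chainWindow (N := N) α n p.1 c} := by
  have hαδ : α < deltaSU (Fin N) := by nlinarith [deltaSU_pos (n := Fin N)]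
  induction n with
  | zero =>
      intro _ c
      refine ⟨fun _ _ => 1, measurable_const, fun _ _ _ => one_ne_zero, fun U => ?_, fun U => continuousOn_const, fun U g => by rw [pow_zero],
        continuousOn_const⟩
      have hid : chainMap (expMeanLogSU (n := Fin N)) 0 U c = id := funext fun g => chainMap_zero _ U c g
      have hW0 : chainWindow α 0 U c = Set.univ := rfl
      rw [hid, hW0, Set.image_id, Measure.map_id, Measure.restrict_univ]
      have h1 : (fun _ : SU N => (((1 : ℝ≥0) : ℝ≥0) : ℝ≥0∞)) = 1 := funext fun _ => ENNReal.coe_one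
      rw [h1, withDensity_one]
  | succ n ih =>
      intro hn c
      obtain ⟨J, hJm, hJ0, hJlaw, hJc, hJlb, hJw⟩ := ih (by omega) (centralBond c)
      obtain ⟨jac, hjacm, hjac0, hfwd, hjc, hjlb, hjg⟩ :=
        exists_jacobian_forwardLaws_lb_graph (N := N) (P := P) (j := n) (by omega) hα0 hα24 hα64 hαL (hgap n) hvol
      have jacm : ∀ (W : GaugeField P n (SU N)), Measurable (jac c W) := fun W =>
        (hjacm c).comp (measurable_const.prodMk measurable_id)
      have hiter := T4Continuum.measurable_iter (fun i => BlockAveraging.blockAvg (P := P) (j := i) (expMeanLogSU (n := Fin N)))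
        (fun j => by rw [BlockAveraging.blockAvg_avg]; exact measurable_avgFun _ measurable_expMeanLogSU_E) n
      refine ⟨fun U g => J U g * jac c (Averaging.iter (fun i => BlockAveraging.blockAvg (P := P) (j := i) (expMeanLogSU (n := Fin N))) n U)
          (chainMap (expMeanLogSU (n := Fin N)) n U (centralBond c) g), ?_, fun U g hg => ?_, fun U => ?_, fun U => ?_,
          fun U g => by rw [pow_succ]; exact mul_le_mul' (hJlb U g) (hjlb c _ _), ?_⟩
      · exact hJm.mul ((hjacm c).comp ((hiter.comp measurable_fst).prodMk (measurable_chainMap₂ n (centralBond c))))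
      · exact mul_ne_zero (hJ0 U g hg.1) (hjac0 c _ _ hg.2)
      rotate_left
      · rw [chainWindow_succ]
        have hf := continuousOn_chainMap (N := N) hαδ (n := n) (by omega) U (centralBond c)
        exact ((hJc U).mono inter_subset_left).mul ((hjc c _).comp (hf.mono inter_subset_left) fun g hg => hg.2)
      · -- joint continuity on the guarded window graph
        have hsub : {p : GaugeField P 0 (SU N) × SU N |
              (∀ k, k < n + 1 → ∀ (c' : PBond P (k + 1)) (i : Idx P),
                dist1 (loopHol (Averaging.iter (fun i => BlockAveraging.blockAvg (P := P) (j := i) (expMeanLogSU (n := Fin N))) k p.1) c' i) ≤ α) ∧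
              p.2 ∈ chainWindow (N := N) α (n + 1) p.1 c} ⊆
            {p : GaugeField P 0 (SU N) × SU N |
              (∀ k, k < n → ∀ (c' : PBond P (k + 1)) (i : Idx P),
                dist1 (loopHol (Averaging.iter (fun i => BlockAveraging.blockAvg (P := P) (j := i) (expMeanLogSU (n := Fin N))) k p.1) c' i) ≤ α) ∧
              p.2 ∈ chainWindow (N := N) α n p.1 (centralBond c)} := fun p hp => by
          refine ⟨fun k hk => hp.1 k (by omega), ?_⟩
          have h2 := hp.2
          rw [chainWindow_succ] at h2
          exact h2.1
        have h1 := hJw.mono hsub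
        have hinner : ContinuousOn (fun p : GaugeField P 0 (SU N) × SU N =>
            ((Averaging.iter (fun i => BlockAveraging.blockAvg (P := P) (j := i) (expMeanLogSU (n := Fin N))) n p.1,
              chainMap (expMeanLogSU (n := Fin N)) n p.1 (centralBond c) p.2) : GaugeField P n (SU N) × SU N))
            {p : GaugeField P 0 (SU N) × SU N |
              (∀ k, k < n + 1 → ∀ (c' : PBond P (k + 1)) (i : Idx P),
                dist1 (loopHol (Averaging.iter (fun i => BlockAveraging.blockAvg (P := P) (j := i) (expMeanLogSU (n := Fin N))) k p.1) c' i) ≤ α) ∧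
              p.2 ∈ chainWindow (N := N) α (n + 1) p.1 c} := fun p hp =>
          (((continuousAt_iter_of_loopSmall (N := N) hαδ p.1 (hsub hp).1).comp_of_eq continuousAt_fst rfl).prodMk
            (continuousAt_chainMap₂ (P := P) (N := N) hαδ (n := n) (by omega) (centralBond c) p.1 p.2 (hsub hp).1 (hsub hp).2)).continuousWithinAt
        have hmaps : MapsTo (fun p : GaugeField P 0 (SU N) × SU N =>
            ((Averaging.iter (fun i => BlockAveraging.blockAvg (P := P) (j := i) (expMeanLogSU (n := Fin N))) n p.1,
              chainMap (expMeanLogSU (n := Fin N)) n p.1 (centralBond c) p.2) : GaugeField P n (SU N) × SU N))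
            {p : GaugeField P 0 (SU N) × SU N |
              (∀ k, k < n + 1 → ∀ (c' : PBond P (k + 1)) (i : Idx P),
                dist1 (loopHol (Averaging.iter (fun i => BlockAveraging.blockAvg (P := P) (j := i) (expMeanLogSU (n := Fin N))) k p.1) c' i) ≤ α) ∧
              p.2 ∈ chainWindow (N := N) α (n + 1) p.1 c}
            {p : GaugeField P n (SU N) × SU N | p.2 ∈ centralWindowSet p.1 c α} :=
          fun p hp => by
            have h2 := hp.2
            rw [chainWindow_succ] at h2
            exact h2.2
        have h2 := (hjg c).comp hinner hmaps
        exact h1.mul h2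
      · -- `chainMap (n+1) = F ∘ f`, `chainWindow (n+1) = W ∩ f⁻¹ Ω`
        set env : GaugeField P n (SU N) := Averaging.iter (fun i => BlockAveraging.blockAvg (P := P) (j := i) (expMeanLogSU (n := Fin N))) n U
          with henv
        set f := chainMap (expMeanLogSU (n := Fin N)) n U (centralBond c) with hfdef
        have hcomp : chainMap (expMeanLogSU (n := Fin N)) (n + 1) U c =
            (fun g => avgFun (expMeanLogSU (n := Fin N)) (update env (centralBond c) g) c) ∘ f := funext fun g => chainMap_succ _ hn U c g
        have hW' : chainWindow α (n + 1) U c = chainWindow α n U (centralBond c) ∩ f ⁻¹' centralWindowSet env c α :=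
          chainWindow_succ α n U c
        have hFm : Measurable (fun g => avgFun (expMeanLogSU (n := Fin N)) (update env (centralBond c) g) c) :=
          (measurable_pi_apply c).comp ((measurable_avgFun _ measurable_expMeanLogSU_E).comp (measurable_update _))
        have hinjF : InjOn (fun g => avgFun (expMeanLogSU (n := Fin N)) (update env (centralBond c) g) c) (centralWindowSet env c α) :=
          fun g₁ hg₁ g₂ hg₂ h => avgFun_update_centralBond_injOn_centralWindow (by omega) _ c hα0 hα24 hαδ (hgap n c) hg₁ hg₂ h
        have hFS : MeasurableSet ((fun g => avgFun (expMeanLogSU (n := Fin N)) (update env (centralBond c) g) c) ''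
            (f '' chainWindow α n U (centralBond c) ∩ centralWindowSet env c α)) := by
          rw [← Set.image_inter_preimage, ← Set.image_comp, ← hcomp, ← hW']
          exact measurableSet_image_chainWindow hα0 hα24 hαδ hgap hn U c (measurableSet_chainWindow α (n + 1) U c) subset_rfl
        have key := forwardLaw_comp (HaarData.haar : Measure (SU N)) (HaarData.haar : Measure (SU N)) (HaarData.haar : Measure (SU N))
          (measurable_chainMap n U (centralBond c)) hFm (measurableSet_centralWindowSet env c α)
          (J := fun g => (J U g : ℝ≥0∞)) (jac := fun g => (jac c env g : ℝ≥0∞))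
          ((show Measurable (J U) from hJm.comp (measurable_const.prodMk measurable_id)).coe_nnreal_ennreal) (jacm env).coe_nnreal_ennreal
          hinjF hFS (hJlaw U) (hfwd c env)
        have hdens : ((fun g => (J U g : ℝ≥0∞)) * ((fun g => (jac c env g : ℝ≥0∞)) ∘ f)) =
            fun g => ((J U g * jac c env (f g) : ℝ≥0) : ℝ≥0∞) := by
          funext g
          simp only [Pi.mul_apply, Function.comp_apply, ENNReal.coe_mul]
        rw [hdens] at key
        rw [hcomp, hW']
        exact key

end Summit.QuantumFields.YangMills.Theorems.FluctuationComparisonRegPrIntLS2BetaChartContChain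

end
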